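import Literature.MathematicalPhysics.QuantumFieldTheory.Balaban1983to89.B9Thm37CubeCoverCommutatorSizesGrad
import Literature.MathematicalPhysics.QuantumFieldTheory.Balaban1983to89.Node00.OpsYRead342
import Literature.MathematicalPhysics.QuantumFieldTheory.Balaban1983to89.B6CubeCoeffSizesV1

/-!
# `Balaban1983to89.B9Thm37CommutatorBound389` — T. Bałaban, *Propagators for lattice gauge theories in a background field*,
# Commun. Math. Phys. **99** (1985) 389–434 [Balaban1985BackgroundPropagators], Sect. C p. 409, **(3.89)**: «Using the inequalities (3.42) for
# G′_□, we get the bound |(K(h_□)G′_□h_□λ)(x)| ≤ O(M⁻¹)e^{−δ₀(Lʲη)⁻¹|y−y′|}|λ| for x ∈ Δ(y), supp λ ⊂ Δ(y′), y, y′ ∈ □ ∈ 𝒟_j» — THE POINTWISE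
# FORM AT def-Y's TORUS LETTERS, for ANY cube letter `O` (= `G′_□(U)`) obeying the first two entries of (3.42) in p21's invariant-class reading, with the
# `O(M⁻¹)` EXPLICIT and UNIFORM IN THE LEVEL `j` (sub-row G-B9-LETTERS, module M5.4-est, file 1; the `h389` majorant slot of Thm 3.7's summation is file 2)

statement-level skeleton of published theorems with citation tags; proofs where landed; nothing here is a claim about the Yang–Mills mass gap

PDF held: `paper:balaban1985-cmp99-background-propagators` (journal page = PDF page + 388); p. 409 read as page image `…-p021-x2.png` + text layer
`p0021.txt`; quotation, input list and level window confirmed from the renders by the [B9] page owner (lit-balaban-r06 g63, cell bus 2026-08-28T01:43Z).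
[4] = [Balaban1984PropagatorsII] p. 230: (2.43) «|(G′(□)λ)(x)|, |(∂^{L^{−j}}_μG′(□)λ)(x)| ≤ O(1)e^{−δ₀dist(x, supp λ)}|λ|», (2.44) «This inequality and (2.40)
imply |(K(h_□)G′(□)h_□λ)(x)| ≤ O(M⁻¹)e^{−δ₀|x−y|}|λ|» — print derives (2.44) ∕ (3.89) from exactly TWO entries of (3.42): the VALUE and ONE GRADIENT.
Cell `lit-balaban`, sub-row G-B9-LETTERS (map `lit-balaban-r06/B9-LETTERS-MAP.md` §4 «M5.4 … est half»), seat p38 gen 37; the comb half is this seat's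
`…B9Thm37CubeCoverCommutators` (p593034) ∕ `…Sizes` (p593694) ∕ `…SizesGrad` (p594005).  SKELETON rows B9.Thm3.7 × B9.Def@408 (cells only).

## THE DISPLAYED INPUTS (hypotheses, NOT asserted — the cube letters' (3.42), supplied by modules M5.1a∕M5.1b∕M5.1c∕M5.2; shapes = p21's
`B9CubeLettersInvReadDict` §2 pointwise Inv readings, unbundled over the test class `‖Λ(z)‖ ≤ |f(z)|` of `B9CubeLettersInvReadings.TestY`; the
bi-contraction hypotheses `hV`, `hT` are `B9CubeLettersInvReadings.IsBiContr (UboxY i V μ)` ∕ `IsBiContr (avgTrY i par V z)` UNFOLDED — no import of p21's files)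
* (h342₀) VALUE: for `supp f ⊂ Δ(βy′)`, `‖Λ‖ ≤ |f|` pointwise, `z ∈ Δ(βy)`: `η²·‖(O V Λ)(z)‖ ≤ B₀·ℓ(y)²·e^{−δ d(y,y′)}·|f|`;
* (h342₁) LEFT GRADIENT: same quantifiers, `η·‖(∇_{V,μ}(O V Λ))(z)‖ ≤ B₀·ℓ(y)·e^{−δ d(y,y′)}·|f|`
  (`η = etaS i`, `ℓ = (geo9K i).len`, `d = (geo9K i).dist`, `|f| = (geo9K i).supNorm (inl f)`; [B9] (3.42) p.397 first two members).
No right-`∇*` entry is used (r06 QUOTATION CHECK #9): the backward bond of the star `st(x)` is the FORWARD gradient at the neighbour `x − e_μ`, transported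
(`norm_cdsS_le_norm_cdS_shift`).

## WHAT THIS FILE PROVES (kernel-checked, 0 sorry, standard axioms; THEOREMS + one real constant `theta389`; no `def … : Prop`, no new fact)
* §1 bookkeeping: `norm_cutMulY_le_of_le` (`h_□Λ` keeps the profile of `Λ`), `norm_cdsS_le_norm_cdS_shift`, `mem_stencilY_iff`, `lev_le_succ_of_touch`
  (adjacent torus sites' levels differ by ≤ 1, (2.2) `TDomains.sepT`), `dist_blkOf_le_one_of_touch` (their blocks are at distance ≤ 1 in `bondT`), `geo9K_dist_eq`,
  `geo9K_len_eq`, `levY_eq_lvl_of_blkOf_eq`; ★ `exists_near_hT_of_KhY_hTY_ne_zero` ⇒ `levY_le_of_KhY_hTY_ne_zero` (where `K(h_□)Ψ ≠ 0` the level is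
  `≤ j + 1`) and `blkOf_mem_QT_of_KhY_hTY_ne_zero` (OUTPUT LOCALISATION: `Δ(z) ∈ QT □`, so `S′_□ = S_□` serves Thm 3.7's count).
* §2 `theta389`, `arith389` (the level bookkeeping as one real inequality), and
  ★★ `norm_KhY_O_hTY_apply_le` — **(3.89) POINTWISE**: for a member with `η = |c_f|⁻¹` (members of record), a corner-free section `ιB` of `β`,
  bi-contraction bond variables and averaging transporters, and a cube letter `O` with (h342₀,₁) at rate `δ ≥ 0`:
  `‖(K(h_□)(V)·O(V)(h_□Λ))(z)‖ ≤ theta389(d, L, B₀, δ)∕(L·M_h) · e^{−δ d(y,y′)} · |f|` for `z ∈ Δ(βy)`, `supp f ⊂ Δ(βy′)`, `‖Λ‖ ≤ |f|`, with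
  `theta389 d ℓ B₀ δ := B₀·(2(d+1)·(5∕8)·C1F·e^{δ}·L² + (d+1)·(5∕8)²·C2F·L² + sLipT)` — print's `O(M⁻¹)`, `M = L·M_h`, UNIFORM IN `j`
  (the `L^{−j}` ∕ `L^{−2j}` of `|∂h_□|` ∕ `|Δh_□|` cancel the `Lʲ` ∕ `L^{2j}` of the gradient ∕ value entries; the `L^{−2·lev}` averaging weight cancels the
  value entry's `L^{2·lev}`; the site `z − e_μ` and the neighbouring blocks cost `L·e^{δ}`).
HONEST SCOPE ∕ DIVERGENCES.  (1) Print's cubes meet levels `j, j+1` only; the tree's cover also has rim cubes (map §8) and the stencil is one bond wider than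
`supp h_□`, whence `lev ≤ j + 1` at the evaluation site and `≤ j + 2` at its backward neighbour — absorbed in the powers of `L` inside `theta389` (factor `L`,
not `M`).  (2) Same rate `δ` and same distance `d(y,y′)` as the input (3.42) ((3.89) prints `(Lʲη)⁻¹|y−y′|` because `y, y′` sit in one cube).  (3)
Corner-free members only (section `ιB` of `β`, as the whole Read342 dictionary `Node00.OpsYRead342`).  (4) `η = |c_f|⁻¹` is a hypothesis (true at the
members of record, `B9Ineq349SiteFromBlocks.etaS_eq_abs_cf_inv`).  (5) Nothing of (3.42), Thm 3.7 or Lemma 2.1 is asserted; nothing continuum ∕ OS ∕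
mass gap ∕ Clay; YM mass gap NOT proved by any of this (Track A conditional rung).  `--supports stmt-QuantumFields-19200`.  Net new unproved facts: 0.
-/

noncomputable section

namespace Literature.MathematicalPhysics.QuantumFieldTheory.Balaban1983to89.B9Thm37CommutatorBound389

open Node00
open B9Thm37CubeCoverCommutators
open B9Thm37CubeCoverCommutatorSizes
open B9Thm37CubeCoverCommutatorSizesGrad
open B6KLevelCensusIndexV1 (KIdx)
open B6Ineq2142KLevelV1 (β lvl beta_level)
open B4Reflection242 (boxDom blk)
open B4TorusKernel.MultiPeriod (torusSupNorm)
open B6MultiLevelBoxOperator (N0 bigSide bigSide_eq one_le_bigSide)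
open B6MultiLevelTorusOperator (tshift unitVec tshift_symm_apply one_le_of_mem)
open B6Geom246MultiLevelBox (bset blkOf blkOf_val lev_eq_of_blkOf_eq blkOf_eq_of_blk_i_eq)
open B6Geom246MultiLevelTorus (bondT TouchT bondT_adj connectedT torusSupNorm_neg)
open B6Cover236MultiLevelBlocks (cubes)
open B6Partition118KLevelTorus (hT abs_hT_le_one)
open B6Partition118KLevelFineSizes (C1F C1F_nonneg)
open B6Partition118KLevelFineSecond (C2F C2F_nonneg)
open B6Partition118KLevelTorusBinders (sLipT sLipT_nonneg lev_le_of_near_suppT)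
open B9GeoNormsKLevelV1 (geo9K)
open B9Eq39Adjoint (R R_inv_R R_smul R_sub)
open scoped Matrix

variable {𝔸 : Type} [NormedRing 𝔸] [NormedAlgebra ℂ 𝔸] [CompleteSpace 𝔸]
variable {d ℓ : ℕ} {hd : 1 ≤ d + 1} {hL : Odd (ℓ + 1) ∧ 1 < ℓ + 1} {b₀ b₁ : ℝ}
variable (i : KIdx d ℓ hd hL b₀ b₁)

/-! ## §1 Bookkeeping: profiles, the backward bond, the stencil, levels and block distances of neighbours -/

omit [CompleteSpace 𝔸] in
/-- `h_□Λ` has the profile of `Λ`: `‖h(z)Λ(z)‖ ≤ |f(z)|` when `|h| ≤ 1` and `‖Λ‖ ≤ |f|` (the test class is stable under cut-offs).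
[cite: Balaban1985BackgroundPropagators, (3.39) p.397, (3.87) p.409] -/
theorem norm_cutMulY_le_of_le {X : Type} {h f : X → ℝ} (hh : ∀ z, |h z| ≤ 1) {Λ : X → 𝔸} (hΛ : ∀ z, ‖Λ z‖ ≤ |f z|) (z : X) :
    ‖cutMulY (𝔸 := 𝔸) h Λ z‖ ≤ |f z| := by
  rw [cutMulY_apply, norm_ofReal_smul]
  calc |h z| * ‖Λ z‖ ≤ 1 * |f z| := mul_le_mul (hh z) (hΛ z) (norm_nonneg _) zero_le_one
    _ = |f z| := one_mul _

/-- **THE BACKWARD BOND IS THE FORWARD GRADIENT AT THE NEIGHBOUR**: `(∇*_{V,μ}Ψ)(z) = −R(U_μ(z−e_μ))⁻¹(∇_{V,μ}Ψ)(z−e_μ)`, hence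
`‖(∇*_{V,μ}Ψ)(z)‖ ≤ ‖(∇_{V,μ}Ψ)(z−e_μ)‖` at bi-contraction bond variables. [cite: Balaban1985BackgroundPropagators, (3.3) p.390, (3.8) p.392, (3.88) p.409 («b ∈ st(x)»)] -/
theorem norm_cdsS_le_norm_cdS_shift (V : CfgY 𝔸 i)
    (hV : ∀ (μ : Fin (d + 1)) (x : SiteY i), ‖(UboxY i V μ x : 𝔸)‖ ≤ 1 ∧ ‖(((UboxY i V μ x)⁻¹ : 𝔸ˣ) : 𝔸)‖ ≤ 1)
    (μ : Fin (d + 1)) (Ψ : SiteY i → 𝔸) (z : SiteY i) :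
    ‖cdsS i V μ Ψ z‖ ≤ ‖cdS i V μ Ψ ((shiftY i μ).symm z)‖ := by
  have e : cdsS i V μ Ψ z = -(R (UboxY i V μ ((shiftY i μ).symm z))⁻¹ (cdS i V μ Ψ ((shiftY i μ).symm z))) := by
    show R (UboxY i V μ ((shiftY i μ).symm z))⁻¹ (Ψ ((shiftY i μ).symm z)) - Ψ z
      = -(R (UboxY i V μ ((shiftY i μ).symm z))⁻¹ (R (UboxY i V μ ((shiftY i μ).symm z)) (Ψ (shiftY i μ ((shiftY i μ).symm z)))
          - Ψ ((shiftY i μ).symm z)))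
    rw [Equiv.apply_symm_apply, R_sub, R_inv_R]
    abel
  rw [e, norm_neg]
  exact B9Eq310Hermitian.norm_R_le (hV μ ((shiftY i μ).symm z)).2 (by rw [inv_inv]; exact (hV μ ((shiftY i μ).symm z)).1) _

/-- membership in the stencil, spelled out. [cite: Balaban1985BackgroundPropagators, (3.88) p.409, bookkeeping] -/
theorem mem_stencilY_iff (z w : SiteY i) :
    w ∈ stencilY i z ↔ w = z ∨ (∃ μ : Fin (d + 1), w = shiftY i μ z) ∨ (∃ μ : Fin (d + 1), w = (shiftY i μ).symm z) ∨ avgCoeffY i z w ≠ 0 := by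
  classical
  unfold stencilY
  simp only [Finset.mem_union, Finset.mem_singleton, Finset.mem_image, Finset.mem_univ, true_and, Finset.mem_filter]
  constructor
  · rintro (((h | ⟨μ, h⟩) | ⟨μ, h⟩) | h)
    · exact Or.inl h
    · exact Or.inr (Or.inl ⟨μ, h.symm⟩)
    · exact Or.inr (Or.inr (Or.inl ⟨μ, h.symm⟩))
    · exact Or.inr (Or.inr (Or.inr h))
  · rintro (h | ⟨μ, h⟩ | ⟨μ, h⟩ | h)
    · exact Or.inl (Or.inl (Or.inl h))
    · exact Or.inl (Or.inl (Or.inr ⟨μ, h.symm⟩))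
    · exact Or.inl (Or.inr ⟨μ, h.symm⟩)
    · exact Or.inr h

/-- **ADJACENT TORUS SITES HAVE LEVELS DIFFERING BY AT MOST ONE** ((2.2): the bands `Λ_j` are wider than `R·M·Lʲ ≥ 1`).
[cite: Balaban1984PropagatorsII, (2.2) p.224] -/
theorem lev_le_succ_of_touch {x x' : SiteY i} (h : torusSupNorm (toKT i).NB (x.1 - x'.1) ≤ 1) :
    levY i x' ≤ levY i x + 1 := by
  by_contra hlt
  push Not at hlt
  have hsep := (toKT i).D.sepT (levY i x + 1) x.1 x.2 x'.1 x'.2 (Nat.lt_succ_self _) (by unfold levY at hlt ⊢; omega)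
  have hR1 : 1 ≤ (toKT i).R := le_trans (by omega) (toKT i).hR
  have hb1 : 1 ≤ bigSide ℓ (toKT i).Mh (levY i x + 1) := one_le_bigSide (toKT i).hMh _
  have h1 : (1 : ℝ) ≤ (((toKT i).R * bigSide ℓ (toKT i).Mh (levY i x + 1) : ℕ) : ℝ) := by
    exact_mod_cast Nat.one_le_iff_ne_zero.2 (Nat.mul_ne_zero_iff.2 ⟨by omega, by omega⟩)
  linarith

/-- the symmetric form: `|lev x − lev x′| ≤ 1` for adjacent torus sites. [cite: Balaban1984PropagatorsII, (2.2) p.224] -/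
theorem lev_le_succ_of_touch' {x x' : SiteY i} (h : torusSupNorm (toKT i).NB (x.1 - x'.1) ≤ 1) :
    levY i x ≤ levY i x' + 1 := by
  refine lev_le_succ_of_touch i (x := x') (x' := x) ?_
  rw [show x'.1 - x.1 = -(x.1 - x'.1) by abel, torusSupNorm_neg (one_le_of_mem x.2)]
  exact h

/-- one torus step is within torus distance `1` of its start: `|z − (z ± e_μ)|_T ≤ 1`. [cite: Balaban1984PropagatorsII, (2.46) p.231, bookkeeping] -/
theorem torusSupNorm_sub_shiftY_le_one (μ : Fin (d + 1)) (z : SiteY i) :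
    torusSupNorm (toKT i).NB (z.1 - (shiftY i μ z).1) ≤ 1 ∧ torusSupNorm (toKT i).NB (z.1 - ((shiftY i μ).symm z).1) ≤ 1 := by
  constructor
  · have e : shiftY i μ z = tshift (toKT i).NB ((1 : ℤ) • unitVec μ) z := by rw [one_smul]; rfl
    rw [e]; exact torusSupNorm_sub_tshift_le_one z μ 1 (Or.inl rfl)
  · have e : (shiftY i μ).symm z = tshift (toKT i).NB ((-1 : ℤ) • unitVec μ) z := by
      rw [neg_one_smul]; exact tshift_symm_apply _ _ _
    rw [e]; exact torusSupNorm_sub_tshift_le_one z μ (-1) (Or.inr rfl)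

/-- **BLOCKS OF ADJACENT SITES ARE AT GRAPH DISTANCE `≤ 1`** in the torus bond graph `bondT` (they touch, (2.46)).
[cite: Balaban1984PropagatorsII, (2.46) p.231 («d(y,y′)»)] -/
theorem dist_blkOf_le_one_of_touch {x x' : SiteY i} (h : torusSupNorm (toKT i).NB (x.1 - x'.1) ≤ 1) :
    (bondT (toKT i).D).dist (blkOf (toKT i).D.toDomains x) (blkOf (toKT i).D.toDomains x') ≤ 1 := by
  by_cases he : blkOf (toKT i).D.toDomains x = blkOf (toKT i).D.toDomains x'
  · rw [he, SimpleGraph.dist_self]; exact zero_le_one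
  · have hadj : (bondT (toKT i).D).Adj (blkOf (toKT i).D.toDomains x) (blkOf (toKT i).D.toDomains x') :=
      bondT_adj.2 ⟨he, x, x', rfl, rfl, h⟩
    rw [SimpleGraph.dist_eq_one_iff_adj.2 hadj]

/-- the geometry's distance IS the torus bond-graph distance of the carrier blocks (unfolding `geo9K → kGeoU → kGeo → geomT`).
[cite: Balaban1984PropagatorsII, (2.46) p.231, dictionary] -/
theorem geo9K_dist_eq (y y' : IBondY i) :
    (geo9K i).dist y y' = ((bondT i.D).dist (β i.hN i.D i.hk y) (β i.hN i.D i.hk y') : ℝ) := rfl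

/-- the geometry's length at an index bond is `L^{level}·|c_f|⁻¹`. [cite: Balaban1984PropagatorsII, (2.1) p.224 («Lʲη»), dictionary] -/
theorem geo9K_len_eq (y : IBondY i) :
    (geo9K i).len y = (((ℓ + 1 : ℕ) : ℝ)) ^ (lvl i.hN i.D i.hk y) / |i.cf| := by
  rw [B9GeoNormsKLevelV1.geo9K_len_kGeo]; exact B6KLevelCensusIndexV1.len_eq i y

/-- the level of a site in the block `β y` is `lvl y`. [cite: Balaban1984PropagatorsII, (2.45) p.231, bookkeeping] -/
theorem levY_eq_lvl_of_blkOf_eq {z : SiteY i} {y : IBondY i} (hz : blkOf i.D.toDomains z = β i.hN i.D i.hk y) :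
    levY i z = lvl i.hN i.D i.hk y := by
  have h1 : i.D.toDomains.lev z.1 = (β i.hN i.D i.hk y).1.1 := lev_eq_of_blkOf_eq i.D.toDomains hz
  rw [beta_level i.hN i.D i.hk (le_trans one_le_two i.hk2)] at h1
  exact h1

/-- `(blkOf z).1.1 = lev z`. [cite: Balaban1984PropagatorsII, (2.45) p.231, bookkeeping] -/
theorem blkOf_fst_fst (z : SiteY i) : (blkOf i.D.toDomains z).1.1 = levY i z := rfl

/-- **WHERE `K(h_□)(V)Ψ` DOES NOT VANISH, `supp h_□` IS ONE STEP AWAY**: there are sites `u, u′` with `Δ(u) = Δ(z)`, `h_□(u′) ≠ 0` and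
`|u − u′|_T ≤ 1` (the stencil of (3.88) is the star of `z` plus the block of `z`). [cite: Balaban1985BackgroundPropagators, (3.88) p.409 («b ∈ st(x)», «x′ ∈ Bʲ(y)»)] -/
theorem exists_near_hT_of_KhY_hTY_ne_zero (par : SiteParY 𝔸 i) (c : ↥(cubes i.D.toDomains)) (V : CfgY 𝔸 i) (Ψ : SiteY i → 𝔸) (z : SiteY i)
    (hz : KhY i par (hTY i c) V Ψ z ≠ 0) :
    ∃ u u' : SiteY i, blkOf i.D.toDomains u = blkOf i.D.toDomains z ∧ hT i.D c u' ≠ 0 ∧ torusSupNorm (toKT i).NB (u.1 - u'.1) ≤ 1 := by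
  obtain ⟨w, hw, hne⟩ := exists_mem_stencilY_ne_of_KhY_ne_zero i par (hTY i c) V Ψ z hz
  have h0 : ∀ u : SiteY i, torusSupNorm (toKT i).NB (u.1 - u.1) ≤ 1 := fun u => by
    rw [sub_self]
    have : torusSupNorm (toKT i).NB (0 : Fin (d + 1) → ℤ) ≤ B4ContourShift.supNorm (0 : Fin (d + 1) → ℤ) :=
      B4TorusKernel.MultiPeriod.torusSupNorm_le_supNorm (one_le_of_mem z.2) _
    refine this.trans (B4Reflection242.supNorm_le_of_forall fun ν => ?_)
    simp
  by_cases hz0 : hTY i c z ≠ 0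
  · exact ⟨z, z, rfl, hz0, h0 z⟩
  · push Not at hz0
    have hw0 : hT i.D c w ≠ 0 := by rw [hz0] at hne; exact hne
    rcases (mem_stencilY_iff i z w).1 hw with h | ⟨μ, h⟩ | ⟨μ, h⟩ | h
    · subst h; exact ⟨w, w, rfl, hw0, h0 w⟩
    · subst h; exact ⟨z, _, rfl, hw0, (torusSupNorm_sub_shiftY_le_one i μ z).1⟩
    · subst h; exact ⟨z, _, rfl, hw0, (torusSupNorm_sub_shiftY_le_one i μ z).2⟩
    · -- block-mate: same block
      have hblk : blk ((ℓ + 1) ^ levY i z) w.1 = blk ((ℓ + 1) ^ levY i z) z.1 := by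
        by_contra hne'
        exact h (by rw [avgCoeffY, B4Reflection242.avgK, if_neg hne'])
      exact ⟨w, w, blkOf_eq_of_blk_i_eq (D := i.D.toDomains) (x := z) (x' := w) (i := levY i z) le_rfl hblk, hw0, h0 w⟩

/-- ★ **WHERE `K(h_□)(V)Ψ` DOES NOT VANISH, THE LEVEL IS AT MOST `j + 1`** (`□` of level `j`; this seat's gen-26 `lev_le_of_near_suppT`).
[cite: Balaban1985BackgroundPropagators, (3.88)–(3.89) p.409 («y, y′ ∈ □ ∈ 𝒟_j»)] -/
theorem levY_le_of_KhY_hTY_ne_zero (par : SiteParY 𝔸 i) (c : ↥(cubes i.D.toDomains)) (V : CfgY 𝔸 i) (Ψ : SiteY i → 𝔸) (z : SiteY i)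
    (hz : KhY i par (hTY i c) V Ψ z ≠ 0) : levY i z ≤ c.1.1 + 1 := by
  obtain ⟨hℓ, hMh, hR, hP5⟩ := side_conditions i
  obtain ⟨u, u', hu, hu', huu'⟩ := exists_near_hT_of_KhY_hTY_ne_zero i par c V Ψ z hz
  have hl : levY i z = levY i u := by rw [← blkOf_fst_fst, ← blkOf_fst_fst, hu]
  rw [hl]
  exact lev_le_of_near_suppT (D := i.D) hℓ hMh hR hP5 c (z := u) (z' := u') hu' huu'

/-- ★ **OUTPUT LOCALISATION OF THE (3.89) TERMS: `(K(h_□)(V)Ψ)(z) ≠ 0 ⟹ Δ(z) ∈ QT □`** (`M_h ≥ 8`: the one-step thickening of `supp h_□` stays in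
the blocks `□⁺ = QT □` of the cube — this seat's gen-26 `B6CubeCoeffSizesV1.blkOf_mem_QT_of_near_hT`), so the localisation sets `S′_□` of the
`R′`-terms in Thm 3.7's summation may be taken `= S_□`. [cite: Balaban1985BackgroundPropagators, (3.89) p.409 («x ∈ Δ(y), … y, y′ ∈ □ ∈ 𝒟_j»), (3.91) p.410] -/
theorem blkOf_mem_QT_of_KhY_hTY_ne_zero (par : SiteParY 𝔸 i) (c : ↥(cubes i.D.toDomains)) (V : CfgY 𝔸 i) (Ψ : SiteY i → 𝔸) (z : SiteY i)
    (hz : KhY i par (hTY i c) V Ψ z ≠ 0) :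
    blkOf i.D.toDomains z ∈ B6Partition118KLevelTorusCentral.QT i.D (B9GeoLemma21KLevelV1.one_le_Mh i) (four_le_P' i) c := by
  obtain ⟨hℓ, _, hR, hP5⟩ := side_conditions i
  obtain ⟨u, u', hu, hu', huu'⟩ := exists_near_hT_of_KhY_hTY_ne_zero i par c V Ψ z hz
  rw [← hu]
  exact B6CubeCoeffSizesV1.blkOf_mem_QT_of_near_hT i.D hℓ i.hM8 hR hP5 (four_le_P' i) c hu' huu'

/-! ## §2 (3.89) pointwise, uniformly in the level -/

/-- **THE CONSTANT OF (3.89)** before division by `M = L·M_h`: `θ₃₈₉(d, L, B₀, δ) := B₀·(2(d+1)·(5∕8)·C1F·e^{δ}·L² + (d+1)·(5∕8)²·C2F·L² + sLipT)`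
(bond part × gradient entry, site part × value entry, averaging line × value entry). [cite: Balaban1985BackgroundPropagators, (3.89) p.409 («O(M⁻¹)»)] -/
def theta389 (d ℓ : ℕ) (B₀ δ : ℝ) : ℝ :=
  B₀ * (2 * ((d : ℝ) + 1) * (5 / 8 * C1F d ℓ) * Real.exp δ * ((ℓ : ℝ) + 1) ^ 2
    + ((d : ℝ) + 1) * ((5 / 8) ^ 2 * C2F d ℓ) * ((ℓ : ℝ) + 1) ^ 2 + sLipT d ℓ)

/-- `θ₃₈₉ ≥ 0` for `B₀ ≥ 0`. [cite: Balaban1985BackgroundPropagators, (3.89) p.409, bookkeeping] -/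
theorem theta389_nonneg (d ℓ : ℕ) {B₀ : ℝ} (hB₀ : 0 ≤ B₀) (δ : ℝ) : 0 ≤ theta389 d ℓ B₀ δ := by
  unfold theta389
  have := C1F_nonneg d ℓ
  have := C2F_nonneg d ℓ
  have := sLipT_nonneg d ℓ
  have := Real.exp_pos δ
  positivity

/-- **THE LEVEL BOOKKEEPING OF (3.89) AS ONE REAL INEQUALITY**: with `lev ≤ j + 1`, the three summands of the print-shape size of `K(h_□)` (coefficients
`L^{−j}`, `L^{−2j}`, `L^{−2·lev}`) against entries of sizes `L·e^{δ}·L^{lev}`, `L^{2·lev}`, `L^{2·lev}` total at most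
`B₀·(2(d+1)(5∕8)C₁e^{δ}L² + (d+1)(5∕8)²C₂L² + s)∕(L·M_h)` — uniformly in `j`. [cite: Balaban1985BackgroundPropagators, (3.89) p.409 («O(M⁻¹)»), arithmetic] -/
theorem arith389 {dR L Mh C₁ C₂ s B₀ eδ E F X : ℝ} {j lev : ℕ} (hd : 0 ≤ dR) (hL1 : 1 ≤ L) (hMh1 : 1 ≤ Mh) (hC₁ : 0 ≤ C₁) (hC₂ : 0 ≤ C₂)
    (hB₀ : 0 ≤ B₀) (heδ : 0 ≤ eδ) (hE : 0 ≤ E) (hF : 0 ≤ F) (hlev : lev ≤ j + 1)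
    (hX : X ≤ 2 * (dR + 1) * (5 / 8 * C₁ / (L * Mh) * (L ^ j)⁻¹) * (B₀ * (L * eδ) * L ^ lev * E * F)
        + (dR + 1) * ((5 / 8) ^ 2 * C₂ / (L * Mh) ^ 2 * ((L ^ j) ^ 2)⁻¹) * (B₀ * (L ^ lev) ^ 2 * E * F)
        + ((L ^ lev) ^ 2)⁻¹ * (s / (L * Mh)) * (B₀ * (L ^ lev) ^ 2 * E * F)) :
    X ≤ B₀ * (2 * (dR + 1) * (5 / 8 * C₁) * eδ * L ^ 2 + (dR + 1) * ((5 / 8) ^ 2 * C₂) * L ^ 2 + s) / (L * Mh) * E * F := by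
  have hL0 : 0 < L := lt_of_lt_of_le one_pos hL1
  have hM0 : 0 < Mh := lt_of_lt_of_le one_pos hMh1
  have hLM : 0 < L * Mh := mul_pos hL0 hM0
  have hLM1 : 1 ≤ L * Mh := by nlinarith
  have hLj : 0 < L ^ j := pow_pos hL0 _
  have hLz : 0 < L ^ lev := pow_pos hL0 _
  have hpow1 : L ^ lev ≤ L ^ j * L := by
    calc L ^ lev ≤ L ^ (j + 1) := pow_le_pow_right₀ hL1 hlev
      _ = L ^ j * L := pow_succ _ _
  -- term 1
  have t1 : 2 * (dR + 1) * (5 / 8 * C₁ / (L * Mh) * (L ^ j)⁻¹) * (B₀ * (L * eδ) * L ^ lev * E * F)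
      ≤ B₀ * (2 * (dR + 1) * (5 / 8 * C₁) * eδ * L ^ 2) / (L * Mh) * E * F := by
    have hq : (L ^ j)⁻¹ * L ^ lev ≤ L := by
      rw [inv_mul_le_iff₀ hLj]; exact hpow1
    have hnn : 0 ≤ 2 * (dR + 1) * (5 / 8 * C₁) / (L * Mh) * (B₀ * (L * eδ) * E * F) := by positivity
    calc 2 * (dR + 1) * (5 / 8 * C₁ / (L * Mh) * (L ^ j)⁻¹) * (B₀ * (L * eδ) * L ^ lev * E * F)
        = (2 * (dR + 1) * (5 / 8 * C₁) / (L * Mh) * (B₀ * (L * eδ) * E * F)) * ((L ^ j)⁻¹ * L ^ lev) := by ring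
      _ ≤ (2 * (dR + 1) * (5 / 8 * C₁) / (L * Mh) * (B₀ * (L * eδ) * E * F)) * L := mul_le_mul_of_nonneg_left hq hnn
      _ = B₀ * (2 * (dR + 1) * (5 / 8 * C₁) * eδ * L ^ 2) / (L * Mh) * E * F := by ring
  -- term 2
  have t2 : (dR + 1) * ((5 / 8) ^ 2 * C₂ / (L * Mh) ^ 2 * ((L ^ j) ^ 2)⁻¹) * (B₀ * (L ^ lev) ^ 2 * E * F)
      ≤ B₀ * ((dR + 1) * ((5 / 8) ^ 2 * C₂) * L ^ 2) / (L * Mh) * E * F := by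
    have hq : ((L ^ j) ^ 2)⁻¹ * (L ^ lev) ^ 2 ≤ L ^ 2 := by
      rw [inv_mul_le_iff₀ (by positivity)]
      calc (L ^ lev) ^ 2 ≤ (L ^ j * L) ^ 2 := pow_le_pow_left₀ hLz.le hpow1 2
        _ = (L ^ j) ^ 2 * L ^ 2 := by ring
    have hq2 : ((L * Mh) ^ 2)⁻¹ ≤ (L * Mh)⁻¹ := by
      rw [inv_le_inv₀ (by positivity) hLM]; nlinarith
    have hnn : 0 ≤ (dR + 1) * ((5 / 8) ^ 2 * C₂) * (B₀ * E * F) := by positivity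
    calc (dR + 1) * ((5 / 8) ^ 2 * C₂ / (L * Mh) ^ 2 * ((L ^ j) ^ 2)⁻¹) * (B₀ * (L ^ lev) ^ 2 * E * F)
        = ((dR + 1) * ((5 / 8) ^ 2 * C₂) * (B₀ * E * F)) * (((L * Mh) ^ 2)⁻¹ * (((L ^ j) ^ 2)⁻¹ * (L ^ lev) ^ 2)) := by ring
      _ ≤ ((dR + 1) * ((5 / 8) ^ 2 * C₂) * (B₀ * E * F)) * ((L * Mh)⁻¹ * L ^ 2) :=
          mul_le_mul_of_nonneg_left (mul_le_mul hq2 hq (by positivity) (by positivity)) hnn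
      _ = B₀ * ((dR + 1) * ((5 / 8) ^ 2 * C₂) * L ^ 2) / (L * Mh) * E * F := by ring
  -- term 3
  have t3 : ((L ^ lev) ^ 2)⁻¹ * (s / (L * Mh)) * (B₀ * (L ^ lev) ^ 2 * E * F) = B₀ * s / (L * Mh) * E * F := by
    have hne : (L ^ lev) ^ 2 ≠ 0 := by positivity
    calc ((L ^ lev) ^ 2)⁻¹ * (s / (L * Mh)) * (B₀ * (L ^ lev) ^ 2 * E * F)
        = (((L ^ lev) ^ 2)⁻¹ * (L ^ lev) ^ 2) * (B₀ * s / (L * Mh) * E * F) := by ring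
      _ = B₀ * s / (L * Mh) * E * F := by rw [inv_mul_cancel₀ hne, one_mul]
  refine hX.trans ?_
  rw [t3]
  calc 2 * (dR + 1) * (5 / 8 * C₁ / (L * Mh) * (L ^ j)⁻¹) * (B₀ * (L * eδ) * L ^ lev * E * F)
        + (dR + 1) * ((5 / 8) ^ 2 * C₂ / (L * Mh) ^ 2 * ((L ^ j) ^ 2)⁻¹) * (B₀ * (L ^ lev) ^ 2 * E * F)
        + B₀ * s / (L * Mh) * E * F
      ≤ B₀ * (2 * (dR + 1) * (5 / 8 * C₁) * eδ * L ^ 2) / (L * Mh) * E * F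
        + B₀ * ((dR + 1) * ((5 / 8) ^ 2 * C₂) * L ^ 2) / (L * Mh) * E * F + B₀ * s / (L * Mh) * E * F :=
        add_le_add (add_le_add t1 t2) le_rfl
    _ = B₀ * (2 * (dR + 1) * (5 / 8 * C₁) * eδ * L ^ 2 + (dR + 1) * ((5 / 8) ^ 2 * C₂) * L ^ 2 + s) / (L * Mh) * E * F := by ring

/-- ★★ **(3.89), POINTWISE, AT def-Y's LETTERS** — for ANY cube letter `O` at the configuration `V` whose value and left-gradient entries obey (3.42)
with constants `(B₀, δ)` in p21's invariant-class reading (displayed hypotheses `h342₀`, `h342₁`), at bi-contraction bond variables and averaging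
transporters, a corner-free member (`ιB` a section of `β`) with `η = |c_f|⁻¹`:
`‖(K(h_□)(V) (O(V)(h_□Λ)))(z)‖ ≤ θ₃₈₉∕(L·M_h) · e^{−δ d(y,y′)} · |f|` for `z ∈ Δ(βy)`, `supp f ⊂ Δ(βy′)`, `‖Λ‖ ≤ |f|` — print's
«|(K(h_□)G′_□h_□λ)(x)| ≤ O(M⁻¹)e^{−δ₀…}|λ|», with `M = L·M_h` and the `O(M⁻¹)` uniform in the cube's level.
[cite: Balaban1985BackgroundPropagators, (3.89) p.409; Balaban1984PropagatorsII, (2.43)–(2.44) p.230] -/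
theorem norm_KhY_O_hTY_apply_le (par : SiteParY 𝔸 i) (c : ↥(cubes i.D.toDomains)) (V : CfgY 𝔸 i)
    (O : (SiteY i → 𝔸) →ₗ[ℂ] (SiteY i → 𝔸)) {B₀ δ : ℝ} (hB₀ : 0 ≤ B₀) (hδ : 0 ≤ δ)
    (hη : etaS i = |i.cf|⁻¹) (ιB : BlkY i → IBondY i) (hι : ∀ s, β i.hN i.D i.hk (ιB s) = s)
    (hV : ∀ (μ : Fin (d + 1)) (x : SiteY i), ‖(UboxY i V μ x : 𝔸)‖ ≤ 1 ∧ ‖(((UboxY i V μ x)⁻¹ : 𝔸ˣ) : 𝔸)‖ ≤ 1)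
    (hT : ∀ z w : SiteY i, ‖(avgTrY i par V z w : 𝔸)‖ ≤ 1 ∧ ‖(((avgTrY i par V z w)⁻¹ : 𝔸ˣ) : 𝔸)‖ ≤ 1)
    (h342₀ : ∀ (f : SiteY i → ℝ) (y y' : IBondY i), (geo9K i).suppIn (Sum.inl f) y' →
      ∀ Λ : SiteY i → 𝔸, (∀ z, ‖Λ z‖ ≤ |f z|) → ∀ z : SiteY i, blkOf i.D.toDomains z = β i.hN i.D i.hk y →
        etaS i ^ 2 * ‖O Λ z‖ ≤ B₀ * (geo9K i).len y ^ 2 * Real.exp (-(δ * (geo9K i).dist y y')) * (geo9K i).supNorm (Sum.inl f))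
    (h342₁ : ∀ (f : SiteY i → ℝ) (y y' : IBondY i), (geo9K i).suppIn (Sum.inl f) y' →
      ∀ Λ : SiteY i → 𝔸, (∀ z, ‖Λ z‖ ≤ |f z|) → ∀ (z : SiteY i) (μ : Fin (d + 1)), blkOf i.D.toDomains z = β i.hN i.D i.hk y →
        etaS i * ‖cdS i V μ (O Λ) z‖ ≤ B₀ * (geo9K i).len y * Real.exp (-(δ * (geo9K i).dist y y')) * (geo9K i).supNorm (Sum.inl f))
    (f : SiteY i → ℝ) (y y' : IBondY i) (hs : (geo9K i).suppIn (Sum.inl f) y')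
    (Λ : SiteY i → 𝔸) (hΛ : ∀ z, ‖Λ z‖ ≤ |f z|) (z : SiteY i) (hz : blkOf i.D.toDomains z = β i.hN i.D i.hk y) :
    ‖KhY i par (hTY i c) V (O (cutMulY (hTY i c) Λ)) z‖
      ≤ theta389 d ℓ B₀ δ / (((ℓ : ℝ) + 1) * i.Mh) * Real.exp (-(δ * (geo9K i).dist y y')) * (geo9K i).supNorm (Sum.inl f) := by
  obtain ⟨_, hMh2, _, _⟩ := side_conditions i
  have hL1 : (1 : ℝ) ≤ (ℓ : ℝ) + 1 := by linarith [(Nat.cast_nonneg ℓ : (0 : ℝ) ≤ ℓ)]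
  have hL0 : (0 : ℝ) < (ℓ : ℝ) + 1 := by linarith
  have hMh1 : (1 : ℝ) ≤ i.Mh := by exact_mod_cast (le_trans (by norm_num) hMh2)
  have hE0 : 0 ≤ Real.exp (-(δ * (geo9K i).dist y y')) := (Real.exp_pos _).le
  have hF0 : 0 ≤ (geo9K i).supNorm (Sum.inl f) := le_trans (abs_nonneg _) (OpsYRead342.abs_le_supNorm_inl i f z)
  have hcf : 0 < |i.cf| := abs_pos.2 i.hcf
  -- the zero case is trivial
  by_cases h0 : KhY i par (hTY i c) V (O (cutMulY (hTY i c) Λ)) z = 0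
  · rw [h0, norm_zero]
    exact mul_nonneg (mul_nonneg (div_nonneg (theta389_nonneg d ℓ hB₀ δ) (by positivity)) hE0) hF0
  -- the level of `z` is at most `j + 1`
  have hlev : levY i z ≤ c.1.1 + 1 := levY_le_of_KhY_hTY_ne_zero i par c V _ z h0
  -- the profile of `h_□Λ`
  have hΛ'f : ∀ w, ‖cutMulY (hTY i c) Λ w‖ ≤ |f w| := norm_cutMulY_le_of_le
    (fun w => abs_hT_le_one i.D (B9GeoLemma21KLevelV1.one_le_Mh i) (B9GeoLemma21KLevelV1.one_le_P i) c w) hΛ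
  -- lengths: `ℓ(y₁) = L^{lev w}·|c_f|⁻¹` whenever `w ∈ Δ(βy₁)`
  have hlen : ∀ {w : SiteY i} {y₁ : IBondY i}, blkOf i.D.toDomains w = β i.hN i.D i.hk y₁ →
      (geo9K i).len y₁ = ((ℓ : ℝ) + 1) ^ levY i w * |i.cf|⁻¹ := fun {w y₁} hw => by
    rw [geo9K_len_eq, ← levY_eq_lvl_of_blkOf_eq i hw, div_eq_mul_inv]; push_cast; rfl
  -- (A) the value entry on the block of `z`
  have hval : ∀ w : SiteY i, blkOf i.D.toDomains w = β i.hN i.D i.hk y →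
      ‖O (cutMulY (hTY i c) Λ) w‖ ≤ B₀ * (((ℓ : ℝ) + 1) ^ levY i z) ^ 2 * Real.exp (-(δ * (geo9K i).dist y y')) * (geo9K i).supNorm (Sum.inl f) := by
    intro w hw
    have h := h342₀ f y y' hs _ hΛ'f w hw
    have hlw : levY i w = levY i z := by rw [← blkOf_fst_fst, ← blkOf_fst_fst, hw, hz]
    rw [hlen hw, hlw, hη] at h
    have e1 : (|i.cf|⁻¹) ^ 2 * ‖O (cutMulY (hTY i c) Λ) w‖
        ≤ (|i.cf|⁻¹) ^ 2 * (B₀ * (((ℓ : ℝ) + 1) ^ levY i z) ^ 2 * Real.exp (-(δ * (geo9K i).dist y y')) * (geo9K i).supNorm (Sum.inl f)) := by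
      refine h.trans (le_of_eq ?_); ring
    exact le_of_mul_le_mul_left e1 (by positivity)
  -- (B) the gradient entry at `z`
  have hgrad : ∀ μ : Fin (d + 1), ‖cdS i V μ (O (cutMulY (hTY i c) Λ)) z‖
      ≤ B₀ * ((ℓ : ℝ) + 1) ^ levY i z * Real.exp (-(δ * (geo9K i).dist y y')) * (geo9K i).supNorm (Sum.inl f) := by
    intro μ
    have h := h342₁ f y y' hs _ hΛ'f z μ hz
    rw [hlen hz, hη] at h
    have e1 : |i.cf|⁻¹ * ‖cdS i V μ (O (cutMulY (hTY i c) Λ)) z‖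
        ≤ |i.cf|⁻¹ * (B₀ * ((ℓ : ℝ) + 1) ^ levY i z * Real.exp (-(δ * (geo9K i).dist y y')) * (geo9K i).supNorm (Sum.inl f)) := by
      refine h.trans (le_of_eq ?_); ring
    exact le_of_mul_le_mul_left e1 (inv_pos.2 hcf)
  -- (C) the backward bond at `z`: the gradient entry at the neighbour `z − e_μ` (level ≤ lev z + 1, block at graph distance ≤ 1)
  have hgrad' : ∀ μ : Fin (d + 1), ‖cdsS i V μ (O (cutMulY (hTY i c) Λ)) z‖
      ≤ B₀ * (((ℓ : ℝ) + 1) * Real.exp δ) * ((ℓ : ℝ) + 1) ^ levY i z * Real.exp (-(δ * (geo9K i).dist y y'))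
          * (geo9K i).supNorm (Sum.inl f) := by
    intro μ
    have hz'b : blkOf i.D.toDomains ((shiftY i μ).symm z) = β i.hN i.D i.hk (ιB (blkOf i.D.toDomains ((shiftY i μ).symm z))) := by
      rw [hι]
    have h := h342₁ f _ y' hs _ hΛ'f ((shiftY i μ).symm z) μ hz'b
    rw [hlen hz'b, hη] at h
    have e1 : |i.cf|⁻¹ * ‖cdS i V μ (O (cutMulY (hTY i c) Λ)) ((shiftY i μ).symm z)‖
        ≤ |i.cf|⁻¹ * (B₀ * ((ℓ : ℝ) + 1) ^ levY i ((shiftY i μ).symm z)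
            * Real.exp (-(δ * (geo9K i).dist (ιB (blkOf i.D.toDomains ((shiftY i μ).symm z))) y')) * (geo9K i).supNorm (Sum.inl f)) := by
      refine h.trans (le_of_eq ?_); ring
    have h2 := le_of_mul_le_mul_left e1 (inv_pos.2 hcf)
    -- the neighbour's level and block
    have htouch : torusSupNorm (toKT i).NB (z.1 - ((shiftY i μ).symm z).1) ≤ 1 := (torusSupNorm_sub_shiftY_le_one i μ z).2
    have hpow : ((ℓ : ℝ) + 1) ^ levY i ((shiftY i μ).symm z) ≤ ((ℓ : ℝ) + 1) * ((ℓ : ℝ) + 1) ^ levY i z := by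
      calc ((ℓ : ℝ) + 1) ^ levY i ((shiftY i μ).symm z) ≤ ((ℓ : ℝ) + 1) ^ (levY i z + 1) :=
            pow_le_pow_right₀ hL1 (lev_le_succ_of_touch i htouch)
        _ = ((ℓ : ℝ) + 1) * ((ℓ : ℝ) + 1) ^ levY i z := by rw [pow_succ]; ring
    have hdist : (geo9K i).dist y y' ≤ 1 + (geo9K i).dist (ιB (blkOf i.D.toDomains ((shiftY i μ).symm z))) y' := by
      rw [geo9K_dist_eq, geo9K_dist_eq, ← hz, ← hz'b]
      have hconn := connectedT (D := i.D) (B9GeoLemma21KLevelV1.one_le_Mh i) (B9GeoLemma21KLevelV1.one_le_P i)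
      have htri := hconn.dist_triangle (u := blkOf i.D.toDomains z) (v := blkOf i.D.toDomains ((shiftY i μ).symm z))
        (w := β i.hN i.D i.hk y')
      have h1 := dist_blkOf_le_one_of_touch i htouch
      have e : ((bondT i.D).dist (blkOf i.D.toDomains z) (β i.hN i.D i.hk y') : ℝ)
          ≤ ((bondT i.D).dist (blkOf i.D.toDomains z) (blkOf i.D.toDomains ((shiftY i μ).symm z)) : ℝ)
            + ((bondT i.D).dist (blkOf i.D.toDomains ((shiftY i μ).symm z)) (β i.hN i.D i.hk y') : ℝ) := by exact_mod_cast htri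
      have h1r : ((bondT i.D).dist (blkOf i.D.toDomains z) (blkOf i.D.toDomains ((shiftY i μ).symm z)) : ℝ) ≤ 1 := by exact_mod_cast h1
      linarith
    have hexp : Real.exp (-(δ * (geo9K i).dist (ιB (blkOf i.D.toDomains ((shiftY i μ).symm z))) y'))
        ≤ Real.exp δ * Real.exp (-(δ * (geo9K i).dist y y')) := by
      rw [← Real.exp_add]
      have := mul_le_mul_of_nonneg_left hdist hδ
      exact Real.exp_le_exp.2 (by linarith)
    calc ‖cdsS i V μ (O (cutMulY (hTY i c) Λ)) z‖ ≤ ‖cdS i V μ (O (cutMulY (hTY i c) Λ)) ((shiftY i μ).symm z)‖ :=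
          norm_cdsS_le_norm_cdS_shift i V hV μ _ z
      _ ≤ _ := h2
      _ ≤ B₀ * (((ℓ : ℝ) + 1) * ((ℓ : ℝ) + 1) ^ levY i z) * (Real.exp δ * Real.exp (-(δ * (geo9K i).dist y y')))
            * (geo9K i).supNorm (Sum.inl f) := by
          refine mul_le_mul_of_nonneg_right ?_ hF0
          exact mul_le_mul (mul_le_mul_of_nonneg_left hpow hB₀) hexp (Real.exp_pos _).le (by positivity)
      _ = _ := by ring
  -- feed the print-shape size of `K(h_□)` (file C) and do the level bookkeeping
  have hTz := hT z
  have hG₁ : ∀ μ : Fin (d + 1),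
      ‖cdS i V μ (O (cutMulY (hTY i c) Λ)) z‖ ≤ B₀ * (((ℓ : ℝ) + 1) * Real.exp δ) * ((ℓ : ℝ) + 1) ^ levY i z
          * Real.exp (-(δ * (geo9K i).dist y y')) * (geo9K i).supNorm (Sum.inl f)
      ∧ ‖cdsS i V μ (O (cutMulY (hTY i c) Λ)) z‖ ≤ B₀ * (((ℓ : ℝ) + 1) * Real.exp δ) * ((ℓ : ℝ) + 1) ^ levY i z
          * Real.exp (-(δ * (geo9K i).dist y y')) * (geo9K i).supNorm (Sum.inl f) := by
    intro μ
    refine ⟨(hgrad μ).trans ?_, hgrad' μ⟩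
    have h1 : (1 : ℝ) ≤ ((ℓ : ℝ) + 1) * Real.exp δ := by
      have : (1 : ℝ) ≤ Real.exp δ := Real.one_le_exp hδ
      nlinarith
    have hb : 0 ≤ B₀ * ((ℓ : ℝ) + 1) ^ levY i z * Real.exp (-(δ * (geo9K i).dist y y')) * (geo9K i).supNorm (Sum.inl f) := by
      positivity
    calc B₀ * ((ℓ : ℝ) + 1) ^ levY i z * Real.exp (-(δ * (geo9K i).dist y y')) * (geo9K i).supNorm (Sum.inl f)
        = 1 * (B₀ * ((ℓ : ℝ) + 1) ^ levY i z * Real.exp (-(δ * (geo9K i).dist y y')) * (geo9K i).supNorm (Sum.inl f)) := (one_mul _).symm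
      _ ≤ (((ℓ : ℝ) + 1) * Real.exp δ)
            * (B₀ * ((ℓ : ℝ) + 1) ^ levY i z * Real.exp (-(δ * (geo9K i).dist y y')) * (geo9K i).supNorm (Sum.inl f)) :=
          mul_le_mul_of_nonneg_right h1 hb
      _ = _ := by ring
  have hGb : ∀ w : SiteY i, avgCoeffY i z w ≠ 0 →
      ‖O (cutMulY (hTY i c) Λ) w‖ ≤ B₀ * (((ℓ : ℝ) + 1) ^ levY i z) ^ 2 * Real.exp (-(δ * (geo9K i).dist y y')) * (geo9K i).supNorm (Sum.inl f) := by
    intro w hw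
    have hblk : blk ((ℓ + 1) ^ levY i z) w.1 = blk ((ℓ + 1) ^ levY i z) z.1 := by
      by_contra hne'
      exact hw (by rw [avgCoeffY, B4Reflection242.avgK, if_neg hne'])
    have hbo : blkOf i.D.toDomains w = blkOf i.D.toDomains z :=
      blkOf_eq_of_blk_i_eq (D := i.D.toDomains) (x := z) (x' := w) (i := levY i z) le_rfl hblk
    exact hval w (by rw [hbo, hz])
  have hmain := norm_KhY_hTY_apply_le_grad i par c V (O (cutMulY (hTY i c) Λ)) z hTz hG₁ (hval z hz) hGb
  rw [C1F_div_bigSide_eq i c.1.1, C2F_div_bigSide_sq_eq i c.1.1] at hmain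
  have hfin := arith389 (X := ‖KhY i par (hTY i c) V (O (cutMulY (hTY i c) Λ)) z‖) (Nat.cast_nonneg d) hL1 hMh1 (C1F_nonneg d ℓ)
    (C2F_nonneg d ℓ) hB₀ (Real.exp_pos δ).le hE0 hF0 hlev hmain
  unfold theta389
  exact hfin

end Literature.MathematicalPhysics.QuantumFieldTheory.Balaban1983to89.B9Thm37CommutatorBound389

end
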